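import Literature.NumberTheory.Automorphic.IrreducibleClassesConstituents     -- ★ `IrrClass.IsConstituentOf` (subquotient shape `N₁ ⁄ N₂`), `Subrepresentation.quotientRep`
import HarnessLib

/-!
# R90-TF · S4 «Ch. 13.1–2» — (ORBIT)∕(SWAP) support, part (c₁): the SUBQUOTIENT LATTICE of a representation —
# second isomorphism theorem `A ⁄ (A ⊓ B) ≅ (A ⊔ B) ⁄ B` as an equivalence of representations, simplicity of the interval
# `[N₂, N₁]` under an irreducible `N₁ ⁄ N₂`, and the «ONE GRADED PIECE» lemma: an irreducible subquotient `M₁ ⁄ M₂` of `ρ`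
# is equivalent to a subquotient `A ⁄ B` with `L ≤ B ≤ A ≤ U` for one step `L ≤ U` of any chain `⊥ ≤ N₂ ≤ N₁ ≤ ⊤`

Cell `hodgecm-mathlib`, crux H413 (`stmt-HodgeConjecture-24833`, lane `--supports … --as helper`), route of record `HCCMUnconditional`
(no route verbs; count-neutral).  Programme R90-TF (brief `director/R90-BRIEF.v2.md` 1f40d54518340a35), section S4 = Rogawski Ch. 13.1–2
(base `R90-C131`); seat R90-C131-p01 (g0); hand «(c) SLOT LEMMA» toward socket S4#B5 `stub_R90_S4_H_lds` ∕ (ORBIT) ∕ (SWAP)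
(R90-C131-p03 (g0) 2026-09-04T16:27:47Z «p01 TAKE (c)(e)»; census `R90/R90-C131-p01/g0/CENSUS-orbit.md` 62930f5ed58633f2).
THEOREMS ONLY (no `def`, no instance, no notation, no named fact, no `sorry`); generic representation theory over a commutative
ring ∕ field `k` and any monoid∕group `Γ`; imports ★ `IrreducibleClassesConstituents` only (for the subquotient shape of ★
`IrrClass.IsConstituentOf` and ★ `Subrepresentation.quotientRep`).

THE SUBQUOTIENT SHAPE.  For subrepresentations `B ≤ A` of `ρ` (Mathlib `Subrepresentation`), the subquotient representation
`A ⁄ B` is spelled EXACTLY as in ★ `IrrClass.IsConstituentOf` (`Automorphic/UnitaryGroupBorelInduction` §5):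
`A.toRepresentation.quotient (B.toSubmodule.comap A.toSubmodule.subtype) fun g _ hx ↦ B.apply_mem_toSubmodule g hx`
(the hypothesis `B ≤ A` is not needed to FORM it: one divides `A` by `A ⊓ B`).

CONTENT.
* §1 `nonempty_subquotient_equiv_of_eq` (equal data, equivalent subquotients) · **`nonempty_subquotient_equiv_sup`** — the SECOND
  ISOMORPHISM THEOREM `A ⁄ (A ⊓ B) ≅ (A ⊔ B) ⁄ B` as a `Representation.Equiv` (Mathlib has the linear version
  `LinearMap.quotientInfEquivSupQuotient`; the `Γ`-equivariance of `[x] ↦ [x]` is checked on representatives).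
* §2 **`eq_or_eq_of_isIrreducible_subquotient`** — if `N₁ ⁄ N₂` is irreducible then every subrepresentation `C` with
  `N₂ ≤ C ≤ N₁` is `N₂` or `N₁` (the interval `[N₂, N₁]` embeds into the simple lattice `Subrepresentation (N₁ ⁄ N₂)`).
* §3 **`exists_subquotient_equiv_between`** — «ONE GRADED PIECE»: for a step `L ≤ U` of subrepresentations and an irreducible
  subquotient `M₁ ⁄ M₂` (`M₂ ≤ M₁`) with `L ⊓ M₁ ≤ M₂` (nothing of `M₁ ⁄ M₂` below `L`) and `M₁ ≤ (U ⊓ M₁) ⊔ M₂` (all of it below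
  `U`), the subquotient `(L ⊔ (U ⊓ M₁)) ⁄ (L ⊔ (U ⊓ M₂))` — squarely inside `[L, U]` — is equivalent to `M₁ ⁄ M₂` (two second
  isomorphisms and the modular law); and **`exists_step_of_isIrreducible_subquotient`** — for the chain `⊥ ≤ N₂ ≤ N₁ ≤ ⊤` one
  of the three steps satisfies these two conditions (the filtration induced on the SIMPLE module `M₁ ⁄ M₂` jumps exactly once).
This is the lattice half of the census road (c) «an irreducible subquotient of a filtered module sits in one graded piece»
([BernsteinZelevinskyASENS1977, §2 (Jordan–Hölder bookkeeping)]; [BushnellHenniart2006, §2]); the coinvariant half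
(exactness of the twisted Jacquet functor, additivity of `dim` on chains) is `Theorems/R90S4TwistedCoinvariantSlot.lean`.

HONEST LABEL: HC_CM is proved only modulo the 7 printed citations (2 remaining named inputs: hLiu418 = stmt-HodgeConjecture-24832,
h413 = stmt-HodgeConjecture-24833) until rung 0 closes; this file is module-theoretic plumbing and discharges none of them.  REL ≠ ★ ≠ BUILT.

## References
[BernsteinZelevinskyASENS1977] I. N. Bernstein, A. V. Zelevinsky, *Induced representations of reductive p-adic groups I*, Ann. Sci. ÉNS 10
(1977), §2 · [BushnellHenniart2006] C. J. Bushnell, G. Henniart, *The Local Langlands Conjecture for GL(2)* (2006), §2 (composition series) ·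
[Rogawski1990] J. D. Rogawski, *Automorphic Representations of Unitary Groups in Three Variables* (1990), §11.1 p. 161, §12.1 p. 171.
-/

set_option autoImplicit false
-- the mandated namespace (brief §3.4) repeats the single-problem summit's segment (`HodgeConjecture.HodgeConjecture`)
set_option linter.dupNamespace false

namespace Summit.HodgeConjecture.HodgeConjecture.R90.S4

open Representation

section Generic

variable {k : Type*} [CommRing k] {Γ : Type*} [Group Γ] {W : Type*} [AddCommGroup W] [Module k W]
  {ρ : Representation k Γ W}

/-! ## §1 Equal data; the second isomorphism theorem as an equivalence of representations -/

/-- Subquotients with equal data are equivalent (the identity). [cite: BushnellHenniart2006, §2] -/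
theorem nonempty_subquotient_equiv_of_eq {A A' B B' : Subrepresentation ρ} (hA : A = A') (hB : B = B') :
    Nonempty ((A.toRepresentation.quotient (B.toSubmodule.comap A.toSubmodule.subtype)
        fun g _ hx ↦ B.apply_mem_toSubmodule g hx).Equiv
      (A'.toRepresentation.quotient (B'.toSubmodule.comap A'.toSubmodule.subtype)
        fun g _ hx ↦ B'.apply_mem_toSubmodule g hx)) := by
  subst hA hB
  exact ⟨.refl _⟩

/-- **Second isomorphism theorem for representations**: `A ⁄ (A ⊓ B) ≅ (A ⊔ B) ⁄ B`, `[x] ↦ [x]` (`Γ`-equivariant: both sides act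
by `ρ g` on representatives). [cite: BushnellHenniart2006, §2] -/
theorem nonempty_subquotient_equiv_sup (A B : Subrepresentation ρ) :
    Nonempty ((A.toRepresentation.quotient ((A ⊓ B).toSubmodule.comap A.toSubmodule.subtype)
        fun g _ hx ↦ (A ⊓ B).apply_mem_toSubmodule g hx).Equiv
      ((A ⊔ B).toRepresentation.quotient (B.toSubmodule.comap (A ⊔ B).toSubmodule.subtype)
        fun g _ hx ↦ B.apply_mem_toSubmodule g hx)) := by
  -- the map `x ↦ [x]`, `A → (A ⊔ B) ⁄ B`
  let ι : ↥A.toSubmodule →ₗ[k] ↥(A ⊔ B).toSubmodule := Submodule.inclusion (le_sup_left : A.toSubmodule ≤ (A ⊔ B).toSubmodule)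
  let s : ↥A.toSubmodule →ₗ[k] ↥(A ⊔ B).toSubmodule ⧸ B.toSubmodule.comap (A ⊔ B).toSubmodule.subtype :=
    (B.toSubmodule.comap (A ⊔ B).toSubmodule.subtype).mkQ ∘ₗ ι
  have hker : (A ⊓ B).toSubmodule.comap A.toSubmodule.subtype ≤ LinearMap.ker s := by
    intro x hx
    rw [LinearMap.mem_ker]
    change Submodule.Quotient.mk (ι x) = (0 : ↥(A ⊔ B).toSubmodule ⧸ B.toSubmodule.comap (A ⊔ B).toSubmodule.subtype)
    rw [Submodule.Quotient.mk_eq_zero, Submodule.mem_comap]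
    exact hx.2
  let f := ((A ⊓ B).toSubmodule.comap A.toSubmodule.subtype).liftQ s hker
  have hf_mk : ∀ x : ↥A.toSubmodule, f (Submodule.Quotient.mk x) = Submodule.Quotient.mk (ι x) := fun _ => rfl
  have hinj : Function.Injective f := by
    rw [← LinearMap.ker_eq_bot, Submodule.eq_bot_iff]
    intro q hq
    induction q using Submodule.Quotient.induction_on with
    | H x =>
      rw [LinearMap.mem_ker, hf_mk, Submodule.Quotient.mk_eq_zero, Submodule.mem_comap] at hq
      exact (Submodule.Quotient.mk_eq_zero _).2 ⟨x.2, hq⟩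
  have hsurj : Function.Surjective f := by
    intro q
    induction q using Submodule.Quotient.induction_on with
    | H y =>
      obtain ⟨a, ha, b, hb, hab⟩ := Submodule.mem_sup.1 y.2
      refine ⟨Submodule.Quotient.mk ⟨a, ha⟩, ?_⟩
      rw [hf_mk]
      refine (Submodule.Quotient.eq _).2 ?_
      rw [Submodule.mem_comap, map_sub]
      show (a : W) - (y : W) ∈ B.toSubmodule
      have : (a : W) - (y : W) = -b := by rw [← hab]; abel
      rw [this]
      exact B.toSubmodule.neg_mem hb
  refine ⟨Representation.Equiv.mk (LinearEquiv.ofBijective f ⟨hinj, hsurj⟩) fun g => ?_⟩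
  refine LinearMap.ext fun q => ?_
  induction q using Submodule.Quotient.induction_on with
  | H x => rfl

/-! ## §2 The interval `[N₂, N₁]` is simple when `N₁ ⁄ N₂` is irreducible -/

/-- **If `N₁ ⁄ N₂` is irreducible, a subrepresentation `C` with `N₂ ≤ C ≤ N₁` is `N₂` or `N₁`**: the image of `C ⊓ N₁` in
`N₁ ⁄ N₂` is a subrepresentation of a simple lattice, hence `⊥` (then `C ≤ N₂`) or `⊤` (then `N₁ ≤ C`).
[cite: BushnellHenniart2006, §2] -/
theorem eq_or_eq_of_isIrreducible_subquotient {k : Type*} [Field k] {W : Type*} [AddCommGroup W] [Module k W]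
    {ρ : Representation k Γ W} {N₁ N₂ : Subrepresentation ρ}
    (hirr : (N₁.toRepresentation.quotient (N₂.toSubmodule.comap N₁.toSubmodule.subtype)
      fun g _ hx ↦ N₂.apply_mem_toSubmodule g hx).IsIrreducible)
    {C : Subrepresentation ρ} (h₂ : N₂ ≤ C) (h₁ : C ≤ N₁) : C = N₂ ∨ C = N₁ := by
  -- the image of `C` in `N₁ ⁄ N₂`, a subrepresentation
  let P : Submodule k ↥N₁.toSubmodule := N₂.toSubmodule.comap N₁.toSubmodule.subtype
  let S : Subrepresentation (N₁.toRepresentation.quotient P fun g _ hx ↦ N₂.apply_mem_toSubmodule g hx) :=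
    { toSubmodule := (C.toSubmodule.comap N₁.toSubmodule.subtype).map P.mkQ
      apply_mem_toSubmodule := by
        rintro g q ⟨x, hx, rfl⟩
        exact ⟨N₁.toRepresentation g x, C.apply_mem_toSubmodule g hx, rfl⟩ }
  rcases hirr.eq_bot_or_eq_top S with hS | hS
  · -- `S = ⊥`: `C ≤ N₂`
    refine Or.inl (le_antisymm (fun x hx => ?_) h₂)
    have hmem : P.mkQ ⟨x, h₁ hx⟩ ∈ S.toSubmodule := ⟨⟨x, h₁ hx⟩, hx, rfl⟩
    rw [hS] at hmem
    change P.mkQ ⟨x, h₁ hx⟩ ∈ (⊥ : Submodule k _) at hmem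
    rw [Submodule.mem_bot, Submodule.mkQ_apply, Submodule.Quotient.mk_eq_zero] at hmem
    exact hmem
  · -- `S = ⊤`: `N₁ ≤ C`
    refine Or.inr (le_antisymm h₁ fun x hx => ?_)
    have hmem : P.mkQ ⟨x, hx⟩ ∈ S.toSubmodule := by rw [hS]; trivial
    obtain ⟨y, hy, hyx⟩ := hmem
    have hd : (y : W) - x ∈ N₂.toSubmodule := by
      have := (Submodule.Quotient.eq P).1 hyx
      simpa [P] using this
    have : (x : W) = y - (y - x) := by abel
    rw [this]
    exact C.toSubmodule.sub_mem hy (h₂ hd)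

/-! ## §3 «One graded piece»: an irreducible subquotient of a filtered representation sits inside one step -/

/-- **The subquotient inside the step.**  Let `L ≤ U` and `M₂ ≤ M₁` be subrepresentations with `L ⊓ M₁ ≤ M₂` and
`M₁ ≤ (U ⊓ M₁) ⊔ M₂`.  Then `L ≤ L ⊔ (U ⊓ M₂) ≤ L ⊔ (U ⊓ M₁) ≤ U` and
`M₁ ⁄ M₂ ≅ (L ⊔ (U ⊓ M₁)) ⁄ (L ⊔ (U ⊓ M₂))`: `M₁ ⁄ M₂ = ((U ⊓ M₁) ⊔ M₂) ⁄ M₂ ≅ (U ⊓ M₁) ⁄ (U ⊓ M₂)` (second isomorphism) and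
`(L ⊔ (U ⊓ M₁)) ⁄ (L ⊔ (U ⊓ M₂)) ≅ (U ⊓ M₁) ⁄ ((U ⊓ M₁) ⊓ (L ⊔ (U ⊓ M₂))) = (U ⊓ M₁) ⁄ (U ⊓ M₂)` (second isomorphism and the
modular law, using `L ⊓ M₁ ≤ M₂`). [cite: BernsteinZelevinskyASENS1977, §2] [cite: BushnellHenniart2006, §2] -/
theorem exists_subquotient_equiv_between {L U M₁ M₂ : Subrepresentation ρ} (hLU : L ≤ U) (hM : M₂ ≤ M₁)
    (hlow : L ⊓ M₁ ≤ M₂) (hhigh : M₁ ≤ (U ⊓ M₁) ⊔ M₂) :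
    L ≤ L ⊔ (U ⊓ M₂) ∧ L ⊔ (U ⊓ M₂) ≤ L ⊔ (U ⊓ M₁) ∧ L ⊔ (U ⊓ M₁) ≤ U ∧
      Nonempty ((M₁.toRepresentation.quotient (M₂.toSubmodule.comap M₁.toSubmodule.subtype)
          fun g _ hx ↦ M₂.apply_mem_toSubmodule g hx).Equiv
        ((L ⊔ (U ⊓ M₁)).toRepresentation.quotient ((L ⊔ (U ⊓ M₂)).toSubmodule.comap (L ⊔ (U ⊓ M₁)).toSubmodule.subtype)
          fun g _ hx ↦ (L ⊔ (U ⊓ M₂)).apply_mem_toSubmodule g hx)) := by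
  refine ⟨le_sup_left, sup_le_sup_left (inf_le_inf_left U hM) L, sup_le hLU inf_le_left, ?_⟩
  -- (1) `M₁ = (U ⊓ M₁) ⊔ M₂` and `(U ⊓ M₁) ⊓ M₂ = U ⊓ M₂`
  have e1 : (U ⊓ M₁) ⊔ M₂ = M₁ := le_antisymm (sup_le inf_le_right hM) hhigh
  have e2 : (U ⊓ M₁) ⊓ M₂ = U ⊓ M₂ :=
    le_antisymm (le_inf (inf_le_left.trans inf_le_left) inf_le_right) (le_inf (inf_le_inf_left U hM) inf_le_right)
  -- (2) modular law: `(U ⊓ M₁) ⊓ (L ⊔ (U ⊓ M₂)) = U ⊓ M₂`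
  have e3 : (U ⊓ M₁) ⊓ (L ⊔ (U ⊓ M₂)) = U ⊓ M₂ := by
    refine le_antisymm ?_ (le_inf (inf_le_inf_left U hM) le_sup_right)
    intro x hx
    have hx1 : x ∈ (U ⊓ M₁).toSubmodule := hx.1
    have hx2 : x ∈ (L ⊔ (U ⊓ M₂)).toSubmodule := hx.2
    rw [Subrepresentation.toSubmodule_sup] at hx2
    obtain ⟨y, hy, z, hz, rfl⟩ := Submodule.mem_sup.1 hx2
    have hyM₁ : y ∈ M₁ := by
      have : y = (y + z) - z := by abel
      rw [this]
      exact M₁.toSubmodule.sub_mem hx1.2 (hM hz.2)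
    have hyM₂ : y ∈ M₂ := hlow ⟨hy, hyM₁⟩
    have hyU : y ∈ U := hLU hy
    exact ⟨U.toSubmodule.add_mem hyU hz.1, M₂.toSubmodule.add_mem hyM₂ hz.2⟩
  have e4 : (U ⊓ M₁) ⊔ (L ⊔ (U ⊓ M₂)) = L ⊔ (U ⊓ M₁) := by
    rw [← sup_assoc, sup_comm (U ⊓ M₁) L, sup_assoc, sup_eq_left.2 (inf_le_inf_left U hM)]
  -- (3) compose: `M₁ ⁄ M₂ ≅ ((U ⊓ M₁) ⊔ M₂) ⁄ M₂ ≅ (U ⊓ M₁) ⁄ ((U ⊓ M₁) ⊓ M₂) ≅ (U ⊓ M₁) ⁄ ((U ⊓ M₁) ⊓ (L ⊔ (U ⊓ M₂))) ≅ … `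
  obtain ⟨φ₁⟩ := nonempty_subquotient_equiv_of_eq (ρ := ρ) e1.symm (rfl : M₂ = M₂)
  obtain ⟨φ₂⟩ := nonempty_subquotient_equiv_sup (ρ := ρ) (U ⊓ M₁) M₂
  obtain ⟨φ₃⟩ := nonempty_subquotient_equiv_of_eq (ρ := ρ) (rfl : U ⊓ M₁ = U ⊓ M₁) (e2.trans e3.symm)
  obtain ⟨φ₄⟩ := nonempty_subquotient_equiv_sup (ρ := ρ) (U ⊓ M₁) (L ⊔ (U ⊓ M₂))
  obtain ⟨φ₅⟩ := nonempty_subquotient_equiv_of_eq (ρ := ρ) e4 (rfl : L ⊔ (U ⊓ M₂) = L ⊔ (U ⊓ M₂))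
  exact ⟨(((φ₁.trans φ₂.symm).trans φ₃).trans φ₄).trans φ₅⟩

/-- **The jump.**  For the chain `⊥ ≤ N₂ ≤ N₁ ≤ ⊤` (`N₂ ≤ N₁`) and an IRREDUCIBLE subquotient `M₁ ⁄ M₂` (`M₂ ≤ M₁`), one of the three
steps `(L, U) ∈ {(⊥, N₂), (N₂, N₁), (N₁, ⊤)}` has `L ⊓ M₁ ≤ M₂` and `M₁ ≤ (U ⊓ M₁) ⊔ M₂`: the subrepresentations
`(F ⊓ M₁) ⊔ M₂ ∈ [M₂, M₁]` (`F = ⊥, N₂, N₁, ⊤`) are each `M₂` or `M₁` (§2) and increase from `M₂` to `M₁`.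
[cite: BernsteinZelevinskyASENS1977, §2] [cite: BushnellHenniart2006, §2] -/
theorem exists_step_of_isIrreducible_subquotient {k : Type*} [Field k] {W : Type*} [AddCommGroup W] [Module k W]
    {ρ : Representation k Γ W} {N₁ N₂ M₁ M₂ : Subrepresentation ρ} (hM : M₂ ≤ M₁)
    (hirr : (M₁.toRepresentation.quotient (M₂.toSubmodule.comap M₁.toSubmodule.subtype)
      fun g _ hx ↦ M₂.apply_mem_toSubmodule g hx).IsIrreducible) :
    (⊥ ⊓ M₁ ≤ M₂ ∧ M₁ ≤ (N₂ ⊓ M₁) ⊔ M₂) ∨ (N₂ ⊓ M₁ ≤ M₂ ∧ M₁ ≤ (N₁ ⊓ M₁) ⊔ M₂) ∨ (N₁ ⊓ M₁ ≤ M₂ ∧ M₁ ≤ (⊤ ⊓ M₁) ⊔ M₂) := by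
  -- `(F ⊓ M₁) ⊔ M₂` is `M₂` or `M₁`
  have key : ∀ F : Subrepresentation ρ, F ⊓ M₁ ≤ M₂ ∨ M₁ ≤ (F ⊓ M₁) ⊔ M₂ := by
    intro F
    rcases eq_or_eq_of_isIrreducible_subquotient hirr (C := (F ⊓ M₁) ⊔ M₂) le_sup_right (sup_le inf_le_right hM) with h | h
    · exact Or.inl (le_sup_left.trans h.le)
    · exact Or.inr h.ge
  by_cases h1 : M₁ ≤ (N₂ ⊓ M₁) ⊔ M₂
  · exact Or.inl ⟨by simp, h1⟩
  by_cases h2 : M₁ ≤ (N₁ ⊓ M₁) ⊔ M₂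
  · exact Or.inr (Or.inl ⟨(key N₂).resolve_right h1, h2⟩)
  · refine Or.inr (Or.inr ⟨(key N₁).resolve_right h2, ?_⟩)
    rw [top_inf_eq]
    exact le_sup_left

end Generic

end Summit.HodgeConjecture.HodgeConjecture.R90.S4
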